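import Literature.Geometry.Riemannian.MetricFlowFTotalBoundedness
import Literature.Geometry.Riemannian.MetricFlowFiniteTimeSubconvergence
import Literature.Geometry.Riemannian.MetricFlowKernelSubconvergence
import HarnessLib

/-!
# Total boundedness of the `𝔽`-distance for sequences of `H`-concentrated metric flow pairs
# (Bamler 2023, §7.3, the total-boundedness half of Thm 7.4) — the registered milestone stub
# `stub_totalBoundedness` of line `ancient-sphere-rigidity` (crux `EntropyRung.SubcylindricalRecognition`,
# stmt-SmoothPoincare4-10869), CLOSED by composition of the landed bricks.

R. Bamler, *Compactness theory of the space of super Ricci flows*, Invent. Math. 233 (2023), §7.3,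
proof of Thm 7.4 (arXiv v1 Thm 155): "To see total boundedness, suppose by contradiction that there is
a sequence … with `d_𝔽 > ε r` for all `i ≠ j` … [Lemmas 164, 165]". Statement (J = ∅, `I = [a, T]`,
compact time-slices — the case of Ricci flows): a sequence of `H`-concentrated metric flow pairs over
`[a, T]`, defined over `(a, T)`, with uniformly bounded variances and compact time-slices has, for every
`ε > 0`, a subsequence all of whose mutual `d_𝔽`-distances are `≤ ε`.

Proof = composition of three landed theorems of the tree: Claim 7.? (arXiv Claim 162)
`exists_subseq_tendsto_map_kernel` (MetricFlowKernelSubconvergence.lean: subsequential `W₁`-convergence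
of pushed conjugate heat kernels via tightness from the gradient property) ⇒ Lemma 7.? (arXiv Lemma 161)
`MetricFlowPair.exists_subseq_familyCorrespondence_finite` (MetricFlowFiniteTimeSubconvergence.lean:
Cauchy within a correspondence over a finite set of times, after a subsequence) ⇒ Lemmas 7.? (arXiv
164, 165) and the total-boundedness argument `MetricFlowPair.totalBoundedness_of_finite_subconvergence`
(MetricFlowFTotalBoundedness.lean: almost-monotone selection of the average distances, covering, the
extension Lemma 7.? (arXiv 160) of §7.2, extension to `[a, T]`). No named facts are used.

## References

* [Bamler2023] R. H. Bamler, *Compactness theory of the space of super Ricci flows*, Invent. Math. 233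
  (2023), 1121–1277 (arXiv:2008.09298), §7.2–7.3, Lemmas 7.? (arXiv v1 160, 161, 164, 165), Thm 7.4.
-/

noncomputable section

open Set MeasureTheory Filter
open scoped Topology ENNReal NNReal

namespace Summit.SmoothPoincare4.SmoothPoincare4.Theorems.SubcylindricalRecognition.AncientSphereRigidity

open Literature.Geometry.Riemannian

/-- **Bamler 2023, §7.3, total boundedness in the proof of Thm 7.4 (arXiv v1 Thm 155 with Lemmas
160–165), `J = ∅`, compact time-slices** — the registered milestone stub `stub_totalBoundedness` of
the line skeleton (r11): for `H ≥ 0`, `a < T`, a sequence `P` of `H`-concentrated metric flow pairs over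
`[a, T]` with `(a, T) ⊆ I'`, `Var(μ_t) ≤ C` and compact time-slices, and `ε > 0`, there is a
subsequence `φ` with `d_𝔽(P (φ i), P (φ j)) ≤ ε` for all `i, j`. Composition of the tree's Claim 162,
Lemma 161 and the Lemma 164/165 assembly. [cite: Bamler2023, §7.3, proof of Thm 7.4; Lemmas 7.? (arXiv v1 161, 164, 165)] -/
theorem stub_totalBoundedness :
    ∀ (H C a T : ℝ), 0 ≤ H → a < T → ∀ P : ℕ → MetricFlowPair.{0} (Set.Icc a T),
      (∀ n, (P n).flow.IsHConcentrated H) → (∀ n, Set.Ioo a T ⊆ (P n).I') →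
      (∀ n (t : (P n).I'), variance ((P n).μ t) ((P n).μ t) ≤ ENNReal.ofReal C) →
      (∀ n (t : (P n).I'), CompactSpace ((P n).flow.Slice t)) →
      ∀ ε : ℝ≥0∞, 0 < ε → ∃ φ : ℕ → ℕ, StrictMono φ ∧
        ∀ i j, MetricFlowPair.fDist ∅ (P (φ i)) (P (φ j)) ≤ ε :=
  fun H C a T hH haT P hP hI hvar hcpt ε hε ↦
    MetricFlowPair.totalBoundedness_of_finite_subconvergence
      (fun hH' hV' P' hP' hI' hvar' hcpt' I₀ hI₀ ↦
        MetricFlowPair.exists_subseq_familyCorrespondence_finite exists_subseq_tendsto_map_kernel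
          hH' hV' P' hP' hI' hvar' hcpt' I₀ hI₀)
      H C a T hH haT P hP hI hvar hcpt ε hε

end Summit.SmoothPoincare4.SmoothPoincare4.Theorems.SubcylindricalRecognition.AncientSphereRigidity

end
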